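import Mathlib
import Summits.CriticalPhenomena.PercolationContinuityZ3.Theorems.PercNearOneGluingNoHeavyLowerTailObserverUnionBound
import Summits.CriticalPhenomena.PercolationContinuityZ3.Theorems.PercNearOneGluingNoHeavyLowerTailCILSteinerPath
import Summits.CriticalPhenomena.PercolationContinuityZ3.Theorems.PercNearOneGluingNoHeavyLowerTailCILReduction
import HarnessLib

/-!
# `NoHeavyLowerTail` (stmt-CriticalPhenomena-4575) — SPIDER observers: a depth-uniform cumulative-isolation bound
# with constant = the weighted degree of the observer (reference graph `G − o`)

Lead seat `prim-nh-lead-4575` gen 6, 2026-08-19 (`--supports stmt-CriticalPhenomena-4575`).  No definitions, no named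
facts, no sorries.  Combines the first-edge union bound (`ObserverUnionBound.lowerTail_le_sum_firstEdge_restrW`,
this seat) with `cil_steinerPath` (prim-gen-swap) applied in `H := G − o` (`restrW {o}ᶜ w`) and with pair counting
(`smallBlock_le_two_mul`).

A SPIDER observer: `o ∉ A` such that every non-relay vertex `x` with `w(o,x) ≠ 0` is, in `H = G − o`, the start of a
STEINER PATH with relay hairs (the hypothesis of `cil_steinerPath` for the weights `restrW {o}ᶜ w`; the legs may have
ANY length, `o` may also carry direct relay edges; the relay side of the graph is arbitrary).

* `spider_lowerTail_le` — for every level `j` and every `M ≥ 0` dominating the relay lightnesses in `H`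
  (`μ_H(|π(a)| ≤ j) ≤ M` for all `a ∈ A`):   `μ(1 ≤ |π(o)| ≤ j) ≤ (Σ_{x ≠ o} w(o,x)) · M`.
  So spiders satisfy CIL relative to `G − o` with constant `deg_w(o)` — uniformly in the leg lengths (depth), in
  `|A|` and in the relay side; linear in the number of legs.
* `spider_smallBlock_le` — with pair counting in `H`: if `μ_H(a ↮ a′) ≤ η` for all relays then
  `μ(1 ≤ |π(o)| ∧ 2|π(o)| ≤ |A|) ≤ (Σ_{x ≠ o} w(o,x)) · 2η`.

READING (LEAD-GEN6 §3b).  Depth-uniform, but the constant is the weighted degree of `o`; `r`-uniformity for long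
legs is open (for legs of length 1 = pendant stars it is `pocketGluing_oneLayer` / `pendantStar_nearOneGluing`), and
`η` is measured in `G − o` (convert to `G` with the hub inequality `offVertex_reliability_transfer` at the price of a
square root, or directly when no relay is glued to `o`).
-/

namespace Summit.CriticalPhenomena.PercolationContinuityZ3.Theorems

open MeasureTheory Set
open Literature.Probability.LatticeModels (prodBernoulli)
open Literature.Probability.Percolation

noncomputable section
open Classical

variable {n : ℕ}

namespace SpiderCIL

/-- Per-neighbour estimate: for `x ≠ o`, `w(o,x) · μ_H(1 ≤ |π(x)| ≤ j) ≤ w(o,x) · M` under the spider hypothesis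
(relays: drop `1 ≤ ·`; weight-`0` pairs: both sides vanish; leg starts: `cil_steinerPath` in `H` with a champion). [this work] -/
theorem term_le (w : Sym2 (Fin n) → unitInterval) (A : Finset (Fin n)) (o : Fin n) (j : ℕ) (M : ℝ) (hM : 0 ≤ M)
    (hlight : ∀ a ∈ A, (prodBernoulli (restrW ({o}ᶜ : Set (Fin n)) w)).real
      {ω : BondConfig (Fin n) | (A.filter fun z => ω ∈ openConn a z).card ≤ j} ≤ M)
    (hlegs : ∀ x : Fin n, x ≠ o → x ∉ A → w s(o, x) ≠ 0 →
      ∃ (k : ℕ) (p : Fin (k + 1) → Fin n), Function.Injective p ∧ p 0 = x ∧ (∀ i, p i ∉ A) ∧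
        (∀ (i : Fin (k + 1)) (v : Fin n), v ∉ A → v ≠ p i →
          0 < (restrW ({o}ᶜ : Set (Fin n)) w s(p i, v) : ℝ) →
          ∃ l : Fin (k + 1), v = p l ∧ (l.val = i.val + 1 ∨ i.val = l.val + 1)))
    {x : Fin n} (hxo : x ≠ o) :
    (w s(o, x) : ℝ) * (prodBernoulli (restrW ({o}ᶜ : Set (Fin n)) w)).real {ω : BondConfig (Fin n) |
        1 ≤ (A.filter fun a => ω ∈ openConn x a).card ∧ (A.filter fun a => ω ∈ openConn x a).card ≤ j} ≤
      (w s(o, x) : ℝ) * M := by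
  set H := restrW ({o}ᶜ : Set (Fin n)) w with hH
  by_cases hw : w s(o, x) = 0
  · have h0 : (w s(o, x) : ℝ) = 0 := by rw [hw]; rfl
    rw [h0, zero_mul, zero_mul]
  refine mul_le_mul_of_nonneg_left ?_ (w s(o, x)).2.1
  by_cases hxA : x ∈ A
  · refine (measureReal_mono (fun ω hω => ?_) (measure_ne_top _ _)).trans (hlight x hxA)
    exact hω.2
  by_cases hA : A.Nonempty
  · obtain ⟨c, hc, hcmax⟩ := Finset.exists_max_image A
      (fun a => (prodBernoulli H).real
        {ω : BondConfig (Fin n) | (A.filter fun z => ω ∈ openConn a z).card ≤ j}) hA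
    obtain ⟨k, p, hpinj, hp0, hpA, hpath⟩ := hlegs x hxo hxA hw
    have key := cil_steinerPath A j k H p hpinj hpA hpath c hc hcmax
    rw [hp0] at key
    exact key.trans (hlight c hc)
  · rw [Finset.not_nonempty_iff_eq_empty] at hA
    have hempty : {ω : BondConfig (Fin n) | 1 ≤ (A.filter fun a => ω ∈ openConn x a).card ∧
        (A.filter fun a => ω ∈ openConn x a).card ≤ j} = ∅ := by
      ext ω
      simp only [hA, Finset.filter_empty, Finset.card_empty, mem_setOf_eq, mem_empty_iff_false, iff_false,
        not_and, not_le]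
      intro h
      exact absurd h (by norm_num)
    rw [hempty, measureReal_empty]
    exact hM

/-- **Spider CIL relative to `G − o`.**  Let `o ∉ A` and suppose every non-relay `x` with `w(o,x) ≠ 0` is the start
of a Steiner path with relay hairs in `H = restrW {o}ᶜ w` (hypothesis `hlegs`, verbatim the hypothesis of
`cil_steinerPath` for `H`).  If `0 ≤ M` and `μ_H(|π(a)| ≤ j) ≤ M` for every `a ∈ A`, then
`μ_w(1 ≤ |π(o)| ≤ j) ≤ (Σ_{x ≠ o} w(o,x)) · M` — uniformly in the leg lengths. [this work] -/
theorem spider_lowerTail_le (w : Sym2 (Fin n) → unitInterval) (A : Finset (Fin n)) (o : Fin n)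
    (ho : o ∉ A) (j : ℕ) (M : ℝ) (hM : 0 ≤ M)
    (hlight : ∀ a ∈ A, (prodBernoulli (restrW ({o}ᶜ : Set (Fin n)) w)).real
      {ω : BondConfig (Fin n) | (A.filter fun z => ω ∈ openConn a z).card ≤ j} ≤ M)
    (hlegs : ∀ x : Fin n, x ≠ o → x ∉ A → w s(o, x) ≠ 0 →
      ∃ (k : ℕ) (p : Fin (k + 1) → Fin n), Function.Injective p ∧ p 0 = x ∧ (∀ i, p i ∉ A) ∧
        (∀ (i : Fin (k + 1)) (v : Fin n), v ∉ A → v ≠ p i →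
          0 < (restrW ({o}ᶜ : Set (Fin n)) w s(p i, v) : ℝ) →
          ∃ l : Fin (k + 1), v = p l ∧ (l.val = i.val + 1 ∨ i.val = l.val + 1))) :
    (prodBernoulli w).real {ω : BondConfig (Fin n) |
        1 ≤ (A.filter fun a => ω ∈ openConn o a).card ∧ (A.filter fun a => ω ∈ openConn o a).card ≤ j} ≤
      (∑ x ∈ (Finset.univ.filter fun x : Fin n => x ≠ o), (w s(o, x) : ℝ)) * M := by
  refine (ObserverUnionBound.lowerTail_le_sum_firstEdge_restrW w A o ho j).trans ?_
  rw [Finset.sum_mul]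
  exact Finset.sum_le_sum fun x hx => term_le w A o j M hM hlight hlegs (Finset.mem_filter.1 hx).2

/-- **Spider small-block bound by pair counting in `G − o`.**  Under the spider hypothesis, if
`μ_H(a ↮ a′) ≤ η` for all `a, a′ ∈ A` (`H = restrW {o}ᶜ w`), then
`μ_w(1 ≤ |π(o)| ∧ 2|π(o)| ≤ |A|) ≤ (Σ_{x ≠ o} w(o,x)) · 2η`. [this work] -/
theorem spider_smallBlock_le (w : Sym2 (Fin n) → unitInterval) (A : Finset (Fin n)) (o : Fin n)
    (ho : o ∉ A) (η : ℝ) (hη : 0 ≤ η)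
    (hpair : ∀ a ∈ A, ∀ a' ∈ A, (prodBernoulli (restrW ({o}ᶜ : Set (Fin n)) w)).real
      (openConn a a' : Set (BondConfig (Fin n)))ᶜ ≤ η)
    (hlegs : ∀ x : Fin n, x ≠ o → x ∉ A → w s(o, x) ≠ 0 →
      ∃ (k : ℕ) (p : Fin (k + 1) → Fin n), Function.Injective p ∧ p 0 = x ∧ (∀ i, p i ∉ A) ∧
        (∀ (i : Fin (k + 1)) (v : Fin n), v ∉ A → v ≠ p i →
          0 < (restrW ({o}ᶜ : Set (Fin n)) w s(p i, v) : ℝ) →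
          ∃ l : Fin (k + 1), v = p l ∧ (l.val = i.val + 1 ∨ i.val = l.val + 1))) :
    (prodBernoulli w).real {ω : BondConfig (Fin n) |
        1 ≤ (A.filter fun a => ω ∈ openConn o a).card ∧ 2 * (A.filter fun a => ω ∈ openConn o a).card ≤ A.card} ≤
      (∑ x ∈ (Finset.univ.filter fun x : Fin n => x ≠ o), (w s(o, x) : ℝ)) * (2 * η) := by
  set H := restrW ({o}ᶜ : Set (Fin n)) w with hH
  -- `2 N ≤ |A|` iff `N ≤ |A| / 2`
  have hset : {ω : BondConfig (Fin n) | 1 ≤ (A.filter fun a => ω ∈ openConn o a).card ∧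
      2 * (A.filter fun a => ω ∈ openConn o a).card ≤ A.card} =
      {ω : BondConfig (Fin n) | 1 ≤ (A.filter fun a => ω ∈ openConn o a).card ∧
      (A.filter fun a => ω ∈ openConn o a).card ≤ A.card / 2} := by
    ext ω
    simp only [mem_setOf_eq, Nat.le_div_iff_mul_le (Nat.succ_pos 1)]
    constructor
    · rintro ⟨h1, h2⟩; exact ⟨h1, by omega⟩
    · rintro ⟨h1, h2⟩; exact ⟨h1, by omega⟩
  rw [hset]
  refine spider_lowerTail_le w A o ho (A.card / 2) (2 * η) (by positivity) (fun a ha => ?_) hlegs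
  have hsb := smallBlock_le_two_mul H A a η ha (hpair a ha)
  refine (measureReal_mono (fun ω hω => ?_) (measure_ne_top _ _)).trans hsb
  simp only [mem_setOf_eq] at hω ⊢
  rw [Nat.le_div_iff_mul_le (Nat.succ_pos 1)] at hω
  omega

end SpiderCIL

end

end Summit.CriticalPhenomena.PercolationContinuityZ3.Theorems
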